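import Literature.MathematicalPhysics.QuantumFieldTheory.Balaban1983to89.B9Thm311PosDefOpenZdPer
import Literature.MathematicalPhysics.QuantumFieldTheory.Balaban1983to89.B9Thm311FlatHolonomyKernelZdPer

/-!
# `Balaban1983to89.B9Thm311OpenAtFlatHolonomyZdPer` — [Balaban1985BackgroundPropagators] Thm 3.11 p. 416 ∕ (3.27) p. 395 ON THE TORUS `T_P` READ ON `ℤᵈ`:
# THE OPENNESS ENGINE RE-BASED AT AN ARBITRARY FLAT PERIODIC BACKGROUND (ANY HOLONOMY) — positivity of `⟨A, Δ_a(U₀)A⟩_per` on `E_𝔤^per(P) ∖ 0` for the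
# GENUINE four-letter periodic record `opsAllZdPer` (dag-n06-b g22) and `RegularAtHPer` («`G_𝔤^per(U₀) = (Δ_a)⁻¹` exists») hold for ALL unitary
# `P`-periodic backgrounds of the regime class NEAR EVERY FLAT ONE `U₁` (plaquette variables `≡ 1`, trivial or non-trivial holonomy), not only near
# `U₀ = 1` (dag-n06-w4 g6 `B9Thm311PosDefOpenZdPer`); the input at the base point is dag-n06-b g23's flat positivity at every flat periodic background
# (`B9Thm311FlatHolonomyKernelZdPer`), and the three base-point facts the continuity machinery asks for are proved here: the loop variables of every
# averaged level are `1`, the averaged transporters are unitary, and the SCALAR operator `Δ′_a(U₁)` is positive definite on `L²(T_P)`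

statement-level skeleton of published theorems with citation tags; proofs where landed; nothing here is a claim about the
Yang–Mills mass gap

`[Balaban1985BackgroundPropagators]` ("B9", CMP **99** (1985) 389–434) Thm 3.11 p. 416: *«There exist constants M₀, α₀′ such that for M ≥ M₀, Mα₀ ≤ α₀′ …
the operators Δ′_a, G′, Q′G′²Q′*, (Q′G′²Q′*)⁻¹, Δ_a, G are positive definite … uniformly in U, Ω_j»*; (3.24) p. 394 (`Δ′_a`), (3.26)–(3.27) p. 395.
`[Balaban1985RegularSpaces]` (1.7) p. 77 (the small-field class `𝔄_k({Ω_j}, α₀)` — it contains EVERY flat background, whatever its holonomy), p. 77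
*«Ω_j = T_η»*.  `[Balaban1985Averaging]` (8)–(11) pp. 18–19 (gauge transformations), (42)–(43) pp. 23–24 (the averages), (45) p. 24 (their covariance).
PDF held: `paper:balaban1985-cmp99-background-propagators` pp. 394–395, 416.

CITATION HEADER (lean-in-tree rule).  Cell `pub-ymgap` (YM Track A), DAG node N06 = [B9], seat `pub-ymgap-dag-n06-b` (g24), the (β′-PERIODIC) road
(director-ym №217 (1)).  WHY: the junction's binder `InvAtHIPer … aI` ∕ `RegularInClassAtHPer` (dag-n06-b g22 `B9Eq327GreenZdHermPer`) asks for
`RegularAtHPer` at EVERY periodic unitary background of the class (1.7) at thresholds `α₀ ≤ aI`; the class contains flat backgrounds with NON-TRIVIAL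
holonomy (LOCATED-SELF-8 of this lineage, dag-n06-w4 I.41000), so openness around `U₀ = 1` alone cannot cover it.  The road (g23's CLAIM-4 line): (flat
positivity at every flat periodic background — g23 `bondPairPer_deltaAOf_opsAllZdPer_pos_of_flat`) + (openness RE-BASED at every flat background — THIS
FILE) + (compactness of the periodic unitary class — the companion `B9Thm311ClassCompactnessZdPer`).  Every continuity tool of dag-n06-w4's chain is already
typed at a GENERAL base point (`continuousAt_bgT`, `continuousAt_QQZdP_branch`, `continuousAt_deltaPrimeAPer`, `continuousAt_covDerivFwd_projRPer_covDivB_le`,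
the engine `bondPairPer_pos_eventually_domSubHPer`); this file supplies the BASE-POINT FACTS at a flat `U₁` and re-runs the assembly.  Nothing is re-declared.

WHAT IS PROVED (kernel, 0 sorry; theorems only — no `def`, no `instance`, no `notation`).
* §1 (flat backgrounds on `ℤᵈ`, any holonomy) `exists_gaugeAct_one_of_flat` (a flat unitary background IS a pure gauge `1^w` with unitary `w`: g23's
  axial-gauge lemma), `avgIter_gaugeAct_one_eq`, `Wcx_gaugeAct_one_eq`, ★ `Wcx_avgIter_eq_one_of_flat` (EVERY loop variable `Ūʲ(Γ_{c,x})Ūʲ(c)⁻¹` of EVERY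
  averaged level is `1`: the averages of a pure gauge are the rescaled pure gauge — `B7Prop6Flat.avgIter_gaugeAct_units`, exact, no smallness),
  ★ `norm_Wcx_avgIter_sub_one_lt_one_of_flat` (the disc condition of the continuity machinery at a flat base point), ★ `bgT_mem_unitaryUnits_of_flat`
  (the averaged transporters `Ūʲ(Γ)` are unitary at EVERY level), `reg17_of_flat` (a flat background lies in every class (1.7)).
* §2 (THE SCALAR FLAT-HOLONOMY KERNEL) ★★ `eq_zero_of_formPer_deltaPrimeAPer_eq_zero_of_flat`: at a flat `P`-periodic unitary `U₁` with ANY holonomy,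
  `⟨f, Δ′_a(U₁)f⟩_{T_P} = 0 ⟹ f = 0` on `L²(T_P, 𝔸)` (`η ≠ 0`, `a ≥ 0`, one active non-empty level-periodic `Λ_{j₀}`): `D_{U₁}f ≡ 0` makes `R(w)⁻¹f`
  step-invariant hence CONSTANT `c` on `ℤᵈ` (g23 `eq_of_forall_step_eq`), and `Q′_{j₀}(U₁)f = R(w_{j₀})Q′_{j₀}(1)c = R(·)c` (`QprimeIter_gaugeAct`,
  `qprimeIter_one_const`) vanishes at a constraint point only if `c = 0`; ★★ `formPer_deltaPrimeAPer_self_pos_of_flat`, ★★ `regularPrimePer_of_flat`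
  (`Δ′_a(U₁)` INVERTIBLE on `L²(T_P)` — Thm 3.11's first clause at every flat background of the torus).
* §3 (THE RE-BASED ENGINE, general base point) ★★ `regularPrimePer_eventually_of_base` (the scalar regime is open at ANY base point `U₁` whose averaged
  loop variables lie in the disc and where `Δ′_a(U₁) > 0`), ★★ `lettersContinuousWithinAt_opsAllZdPer_of_base` (all four letters of the genuine periodic
  `Δ_a(U₀)` continuous within the regime set at such a `U₁ ∈ 𝒰`), ★★★ `bondPairPer_pos_eventually_opsAllZdPer_of_base` and ★★★
  `regularAtHPer_eventually_opsAllZdPer_of_base` (positivity ∕ `RegularAtHPer` for all `U₀ ∈ 𝒰` NEAR `U₁`, given the three base-point facts) — dag-n06-w4's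
  §2–§4 with `1` replaced by `U₁` VERBATIM otherwise.
* §4 (AT A FLAT BASE POINT) ★★★ `bondPairPer_pos_eventually_opsAllZdPer_of_flat`, ★★★ `regularAtHPer_eventually_opsAllZdPer_of_flat` (the three base-point
  facts DISCHARGED by §1–§2 and g23: only the member geometry, the regime set `𝒰 ∋ U₁` and the flat positivity of the record REMAIN displayed).
* §5 (AT THE TORUS MEMBER OF RECORD `torusIdx`) ★★★★ `regularAtHPer_eventually_torusIdx_of_flat` and ★★★★ `regularAtHPer_eventually_torusIdx_canonical_of_flat`:
  for `2 ≤ L`, `Lᵐ ∣ P`, a faithful Hermitian tracial `τ` on a finite-dimensional fibre and EVERY flat `P`-periodic unitary `U₁`: `RegularAtHPer` for the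
  genuine periodic record at `torusIdx` holds for all `U₀` NEAR `U₁` WITHIN the canonical regime set `{unitary, P-periodic, Reg17 (α_Q∕L²), Ūʲ(Γ) unitary
  for j ≤ m}` — NO displayed binder (geometry by `rfl`, flat positivity by g23 `regularAtHPer_opsAllZdPer_of_flat_torusIdx` BY NAME).

HONEST SCOPE.  (i) Openness and continuity only: the neighbourhood of each flat `U₁` is member-, class- and `U₁`-dependent (product topology on backgrounds);
the companion file turns the family of neighbourhoods into ONE threshold `aI` by compactness — still NOT print's uniform `M₀, α₀′`, no estimate of [B9]
(Thm 3.1 ∕ 3.3 ∕ (3.42) NOT proved).  (ii) The positivity input at the base point is g23's theorem at the all-torus classes `torusLam ∕ torusLamb`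
(`Ω_j = ℤᵈ`); at a general member it stays displayed (`hposU₁`).  (iii) Count-neutral; N05 ∕ N06 NOT discharged; K1⁹ `stmt-QuantumFields-27364` NOT closed;
one finite `𝕋⁴` programme at fixed `ε`, Bałaban as printed; R4 closes only the conditional finite-`𝕋⁴` rung `BalabanLadder.UV` — nothing continuum ∕ ℝ⁴ ∕ OS ∕
mass gap ∕ Clay.  Unit `pub-ymgap-dag-n06-b` (g24), 2026-08-28.
-/

noncomputable section

namespace Literature.MathematicalPhysics.QuantumFieldTheory.Balaban1983to89.B9Thm311OpenAtFlatHolonomyZdPer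

open Filter Topology
open B7Prop1Explicit B7Eq78Linearization
open B7Prop2Explicit (unitaryUnits avgIter hol_mem_of)
open B7Prop1Local (InBox loK bondHiK)
open B7AvgGaugeCovariance (uLev)
open B8Ineq132 (covDerivFwd plaqF conjR_conjR one_conjR)
open B8Eq119TwistedAxial (bgT bgT_one)
open B8LeafModelZd (ZdIdx)
open T4TermwiseTorus (IsPeriodic box tcls tlift tlift_mem_box)
open B9SupplySockB9P3ZdLetters (OpsZd deltaAOf)
open B9SupplySockB9P3ZdGammaInAkDpZd (withDpZd)
open B9Eq316AveragingTransposeZd (tauForm tauForm_apply Reg17 alphaQ alphaQ_pos)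
open B9Eq316AveragingTransposeZdPrinted (QQZdP withQQP)
open B9Eq327GreenZd (LinearOnDomAt)
open B9Eq327GreenZdHermPer (domSubHPer mem_domSubHPer_iff finiteDimensional_domSubHPer RegularAtHPer bondPairPer mem_domSub_univ)
open B9Eq321LandauProjectionZdPer (perSub formPer finiteDimensional_perSub)
open B9Eq321LandauMultiplierIffZdPer (eq_pow_mul_div_of_dvd mem_iff_tlift_mem_of_isPeriodic)
open B9Eq324DeltaPrimeAZdPer (deltaPrimeAPer RegularPrimePer bijective_of_form_pos covDerivFwd_eq_zero_of_form_eq_zero qprimeIter_eq_zero_of_form_eq_zero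
  qprimeIter_one_const formPer_deltaPrimeAPer_self_nonneg)
open B9Eq325QGGQInvZdPer (QprimeStarPerInjective)
open B9Eq325ProjContinuityZdPer (continuousAt_deltaPrimeAPer)
open B9Eq325ProjFormulaZdPerLevels (continuousAt_covDerivFwd_projRPer_covDivB_le)
open B9Eq325ProjContinuityZd (continuousAt_bgT)
open B9Thm311PosDefOpenZd (posDef_eventually_of_continuousWithinAt)
open B9Thm311PosDefNearFlatZd (continuousAt_QQZdP_branch)
open B9Thm311PosDefOpenZdPer (bondPairPer_pos_eventually_domSubHPer)
open B9SupplySockB9P3ZdAllLettersZdPer (opsLandauPer opsAllZdPer deltaAOf_opsAllZdPer_apply linearOnDomAt_opsAllZdPer_univ regularAtHPer_opsAllZdPer_of_pos)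
open B9Thm311FlatHolonomyKernelZdPer (eq_of_forall_step_eq gaugeAct_axialFn_eq_one_of_flat)
open B9Eq333ProjectionCovarianceZd (QprimeIter_gaugeAct gaugeAct_inv_gaugeAct inv_mem_unitaryUnits)

-- `Site` alone could resolve to the torus sites of `Setup.lean`; re-export the `ℤ^d` sites of `B7Prop1Explicit`.
export B7Prop1Explicit (Site)

variable {d : ℕ} {𝔸 : Type*} [CStarAlgebra 𝔸]

/-! ## §1  Flat backgrounds on `ℤᵈ` (any holonomy): pure gauge, loop variables of the averages, unitarity of the averaged transporters -/

section Flat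

/-- ★ **A FLAT UNITARY BACKGROUND ON `ℤᵈ` IS A PURE GAUGE WITH A UNITARY GAUGE FUNCTION**: if every plaquette variable of `U₁` is `1` then `U₁ = 1^w`
(`gaugeAct w 1`) for a unitary-valued `w` — the inverse of the axial gauge function of [Balaban1985Averaging] p. 24 (g23's `gaugeAct_axialFn_eq_one_of_flat`;
the lattice `ℤᵈ` is contractible, so the holonomy of `U₁` around the torus cycles lives in the quasi-periodicity of `w`, not in an obstruction).
[cite: Balaban1985Averaging, (8)–(9) p.18, pp.24–25; Balaban1985RegularSpaces, (1.7) p.77] -/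
theorem exists_gaugeAct_one_of_flat {U₁ : Site d → Fin d → 𝔸ˣ} (hU₁ : ∀ x κ, U₁ x κ ∈ unitaryUnits 𝔸)
    (hflat : ∀ (κ ν : Fin d) (x : Site d), plaqF U₁ κ ν x = 1) :
    ∃ w : Site d → 𝔸ˣ, (∀ x, w x ∈ unitaryUnits 𝔸) ∧ U₁ = gaugeAct w (1 : Site d → Fin d → 𝔸ˣ) := by
  have hflatH : ∀ (x : Site d) (κ μ : Fin d), κ ≠ μ → hol U₁ x (plaqWord κ μ) = 1 := by
    intro x κ μ _
    exact Units.ext (by rw [Units.val_one]; exact hflat κ μ x)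
  have hpure : gaugeAct (axialFn U₁ 0) U₁ = 1 := gaugeAct_axialFn_eq_one_of_flat U₁ hflatH 0
  have huU : ∀ x, axialFn U₁ 0 x ∈ unitaryUnits 𝔸 := fun x => hol_mem_of hU₁ 0 _
  refine ⟨(axialFn U₁ 0)⁻¹, inv_mem_unitaryUnits huU, ?_⟩
  rw [← hpure, gaugeAct_inv_gaugeAct]

/-- **THE AVERAGES OF A PURE GAUGE ARE THE RESCALED PURE GAUGE**: `\overline{(1^w)}ʲ = 1^{w_j}`, `w_j(z) = w(Lʲz)` — [Balaban1985Averaging] (45) iterated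
(`B7Prop6Flat.avgIter_gaugeAct_units`, exact, no smallness) and `Ū(1) = 1`. [cite: Balaban1985Averaging, (45) p.24, (43) p.24, (11) p.19] -/
theorem avgIter_gaugeAct_one_eq (L : ℕ) (w : Site d → 𝔸ˣ) (j : ℕ) :
    avgIter L (gaugeAct w (1 : Site d → Fin d → 𝔸ˣ)) j = gaugeAct (uLev L w j) (1 : Site d → Fin d → 𝔸ˣ) := by
  rw [B7Prop6Flat.avgIter_gaugeAct_units, B8Ineq132.avgIter_one]

/-- the loop variables `V(Γ_{c,x})V(c)⁻¹` of (42) at a pure gauge are `1` (a closed loop, conjugated by `w(c₋)`). [cite: Balaban1985Averaging, (42) p.23, (45) p.24, (8) p.18] -/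
theorem Wcx_gaugeAct_one_eq (L : ℕ) (w : Site d → 𝔸ˣ) (q : Site d) (κ : Fin d) (r : Site d) :
    Wcx L (gaugeAct w (1 : Site d → Fin d → 𝔸ˣ)) q κ r = 1 := by
  rw [Wcx_gaugeAct, B8Ineq130.Wcx_one, mul_one, mul_inv_cancel]

/-- ★ **AT A FLAT UNITARY BACKGROUND EVERY LOOP VARIABLE OF EVERY AVERAGED LEVEL IS `1`**: `Ūʲ(Γ_{c,x})Ūʲ(c)⁻¹ = 1` for all `j`, all `L`-bonds `c` and all
`x ∈ B(c₋)` — whatever the holonomy of `U₁` around the cycles of the torus. [cite: Balaban1985Averaging, (42)–(43) pp.23–24, (45) p.24; Balaban1985RegularSpaces, (1.29) p.81] -/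
theorem Wcx_avgIter_eq_one_of_flat (L : ℕ) {U₁ : Site d → Fin d → 𝔸ˣ} (hU₁ : ∀ x κ, U₁ x κ ∈ unitaryUnits 𝔸)
    (hflat : ∀ (κ ν : Fin d) (x : Site d), plaqF U₁ κ ν x = 1) (j : ℕ) (q : Site d) (κ : Fin d) (r : Site d) :
    Wcx L (avgIter L U₁ j) q κ r = 1 := by
  obtain ⟨w, -, rfl⟩ := exists_gaugeAct_one_of_flat hU₁ hflat
  rw [avgIter_gaugeAct_one_eq, Wcx_gaugeAct_one_eq]

/-- ★ **THE DISC CONDITION OF THE CONTINUITY MACHINERY HOLDS AT EVERY FLAT BACKGROUND**: `‖Ūⁱ(Γ_{c,x})Ūⁱ(c)⁻¹ − 1‖ < 1` for all levels `i` (the hypothesis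
`hsmall` of `continuousAt_bgT` ∕ `continuousAt_QQZdP_branch` ∕ `continuousAt_linCovIter`: the series logarithm (21) of the averages is analytic there).
[cite: Balaban1985Averaging, (21) p.21, (42)–(43) pp.23–24] -/
theorem norm_Wcx_avgIter_sub_one_lt_one_of_flat (L : ℕ) {U₁ : Site d → Fin d → 𝔸ˣ} (hU₁ : ∀ x κ, U₁ x κ ∈ unitaryUnits 𝔸)
    (hflat : ∀ (κ ν : Fin d) (x : Site d), plaqF U₁ κ ν x = 1) (i : ℕ) (q : Site d) (κ : Fin d) (r : Fin d → Fin L) :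
    ‖((Wcx L (avgIter L U₁ i) q κ (boxVec L r) : 𝔸ˣ) : 𝔸) - 1‖ < 1 := by
  rw [Wcx_avgIter_eq_one_of_flat L hU₁ hflat, Units.val_one, sub_self, norm_zero]
  exact zero_lt_one

/-- ★ **AT A FLAT UNITARY BACKGROUND THE AVERAGED TRANSPORTERS `Ūʲ(Γ_{y,x})` ARE UNITARY AT EVERY LEVEL** (`bgT_gaugeAct`: they are `w_j(Ly)·1·w_j(x)⁻¹`).
[cite: Balaban1985RegularSpaces, (1.29) p.81; Balaban1985Averaging, (11) p.19, (45) p.24] -/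
theorem bgT_mem_unitaryUnits_of_flat (L : ℕ) {U₁ : Site d → Fin d → 𝔸ˣ} (hU₁ : ∀ x κ, U₁ x κ ∈ unitaryUnits 𝔸)
    (hflat : ∀ (κ ν : Fin d) (x : Site d), plaqF U₁ κ ν x = 1) (j : ℕ) (y x : Site d) : bgT L U₁ j y x ∈ unitaryUnits 𝔸 := by
  obtain ⟨w, hw, rfl⟩ := exists_gaugeAct_one_of_flat hU₁ hflat
  rw [B8Ineq159GaugeCovariance.bgT_gaugeAct, bgT_one, mul_one]
  exact (unitaryUnits 𝔸).mul_mem (hw _) ((unitaryUnits 𝔸).inv_mem (hw _))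

/-- a flat background lies in the class (1.7) of every member at every positive window (all its plaquette variables are `1`; this lineage's
`reg17_of_plaqF_eq_one`). [cite: Balaban1985RegularSpaces, (1.7) p.77] -/
theorem reg17_of_flat {L : ℕ} (hL : 1 ≤ L) (m : ℕ) (Ω : ℕ → Set (Site d)) {α : ℝ} (hα : 0 < α) {U₁ : Site d → Fin d → 𝔸ˣ}
    (hflat : ∀ (κ ν : Fin d) (x : Site d), plaqF U₁ κ ν x = 1) : Reg17 L m Ω α U₁ :=
  B9Eq316AveragingSquaresZdPer.reg17_of_plaqF_eq_one hL m Ω hα hflat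

end Flat

/-! ## §2  The scalar flat-holonomy kernel: `Δ′_a(U₁)` is positive definite on `L²(T_P)` at every flat periodic background -/

section Scalar

variable (τ : 𝔸 →ₗ[ℂ] ℂ) {L : ℕ} [NeZero L] {η : ℝ} {m : ℕ} {a : ℕ → ℝ} {Λs : ℕ → Set (Site d)} {P : ℕ} [NeZero P]

omit [NeZero L] [NeZero P] in
/-- conjugation by a unit is injective: `R(u)a = 0 ⟹ a = 0`. [cite: Balaban1985RegularSpaces, (1.11) p.77 (bookkeeping)] -/
private theorem eq_zero_of_conjR_eq_zero (u : 𝔸ˣ) {x : 𝔸} (h : conjR u x = 0) : x = 0 := by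
  have h1 : conjR u⁻¹ (conjR u x) = x := by rw [conjR_conjR, inv_mul_cancel, one_conjR]
  calc x = conjR u⁻¹ (conjR u x) := h1.symm
    _ = 0 := by rw [h]; simp [conjR]

/-- ★★ **THE KERNEL OF `⟨f, Δ′_a(U₁)f⟩_{T_P}` IS TRIVIAL AT EVERY FLAT PERIODIC BACKGROUND, ANY HOLONOMY**: `U₁` unitary, `P`-periodic, all plaquette
variables `1`; `η ≠ 0`, `a ≥ 0`, `Lᵐ ∣ P`, a tracial faithful `τ`, ONE level `j₀ ≤ m` with `a_{j₀} > 0` whose constraint set `Λ_{j₀}` is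
`(P∕L^{j₀})`-periodic and NON-EMPTY.  Then `⟨f, Δ′_a(U₁)f⟩ = 0 ⟹ f = 0`: the Laplacian part forces `D_{U₁}f ≡ 0`; writing `U₁ = 1^w` (§1),
`F := R(w)⁻¹f` has `D_1 F ≡ 0`, hence is a CONSTANT `c` on `ℤᵈ` (g23's zero-step lemma — `F` need not be periodic); the averaging part gives
`Q′_{j₀}(U₁)f = 0` at a constraint point, and `Q′_{j₀}(1^w)(R(w)c) = R(w_{j₀})Q′_{j₀}(1)c = R(w_{j₀})c` ((3.32), `QprimeIter_gaugeAct`;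
`qprimeIter_one_const`), so `c = 0`.  The `U₁ = 1` case is dag-n06-w4's `eq_zero_of_formPer_deltaPrimeAPer_one_eq_zero`.
[cite: Balaban1985BackgroundPropagators, Thm 3.11 p.416 («Δ′_a, G′ … are positive definite»), (3.24) p.394, (3.32) p.395; Balaban1985RegularSpaces, (1.7) p.77] -/
theorem eq_zero_of_formPer_deltaPrimeAPer_eq_zero_of_flat (hη : η ≠ 0) (hL : 1 ≤ L) (hτt : ∀ a b : 𝔸, τ (a * b) = τ (b * a))
    (hτp : ∀ a : 𝔸, a ≠ 0 → 0 < (τ (star a * a)).re)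
    (hP : L ^ m ∣ P) (ha : ∀ j, 0 ≤ a j) {j₀ : ℕ} (hj₀ : j₀ ≤ m) (haj₀ : 0 < a j₀)
    (hΛ₀ : IsPeriodic (P / L ^ j₀) fun y => y ∈ Λs j₀) (hne : (Λs j₀).Nonempty)
    {U₁ : Site d → Fin d → 𝔸ˣ} (hU₁ : ∀ x κ, U₁ x κ ∈ unitaryUnits 𝔸) (hU : IsPeriodic P U₁)
    (hflat : ∀ (κ ν : Fin d) (x : Site d), plaqF U₁ κ ν x = 1) {f : perSub (𝔸 := 𝔸) (d := d) P}
    (h0 : formPer τ P f (deltaPrimeAPer L U₁ η m a Λs P f) = 0) : f = 0 := by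
  have hT : ∀ (j : ℕ) (z y : Site d), bgT L U₁ j z y ∈ unitaryUnits 𝔸 := bgT_mem_unitaryUnits_of_flat L hU₁ hflat
  -- `D_{U₁}f ≡ 0`
  have hD := covDerivFwd_eq_zero_of_form_eq_zero τ hτt hτp hU₁ hT hU hP ha h0 (η := η) (Λs := Λs)
  obtain ⟨w, hw, hUeq⟩ := exists_gaugeAct_one_of_flat hU₁ hflat
  -- `F := R(w)⁻¹ f` is flat-constant
  set F : Site d → 𝔸 := fun z => conjR (w z)⁻¹ ((f : Site d → 𝔸) z) with hF
  have hfF : ∀ z, (f : Site d → 𝔸) z = conjR (w z) (F z) := fun z => by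
    simp only [hF, conjR_conjR, mul_inv_cancel, one_conjR]
  have hDF : ∀ (μ : Fin d) (x : Site d), covDerivFwd η (1 : Site d → Fin d → 𝔸ˣ) μ F x = 0 := by
    intro μ x
    have h1 := B9Eq340HolderZd.covDerivFwd_gaugeAct η w (1 : Site d → Fin d → 𝔸ˣ) μ (F := F) (Fu := (f : Site d → 𝔸)) hfF x
    rw [← hUeq, hD μ x] at h1
    exact eq_zero_of_conjR_eq_zero (w x) h1.symm
  have hstep : ∀ (x : Site d) (κ : Fin d), F (x + e κ) = F x := by
    intro x κ
    have h1 := hDF κ x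
    rw [B8Eq191FlatStencils.covDerivFwd_flat_apply, smul_eq_zero] at h1
    exact sub_eq_zero.1 (h1.resolve_left (inv_ne_zero hη))
  have hconst : ∀ x, F x = F 0 := eq_of_forall_step_eq F hstep
  -- the penalty at a representative of a point of `Λ_{j₀}` kills the constant
  obtain ⟨y₁, hy₁⟩ := hne
  set Q : ℕ := P / L ^ j₀ with hQ
  have hPQ : P = L ^ j₀ * Q := eq_pow_mul_div_of_dvd hP hj₀
  haveI : NeZero Q := ⟨fun hq => NeZero.ne P (by rw [hPQ, hq, mul_zero])⟩
  have hy₀ : tlift (tcls Q y₁) ∈ Λs j₀ := (mem_iff_tlift_mem_of_isPeriodic hΛ₀ y₁).1 hy₁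
  have hQ0 := qprimeIter_eq_zero_of_form_eq_zero τ hτt hτp hU₁ hT hU hP ha h0 hj₀ haj₀ hy₀ (by rw [← hQ]; exact tlift_mem_box _)
  have hfc : (f : Site d → 𝔸) = fun z => conjR (w z) (F 0) := funext fun z => by rw [hfF z, hconst z]
  rw [hfc, hUeq, QprimeIter_gaugeAct L w (1 : Site d → Fin d → 𝔸ˣ) j₀ (fun _ => F 0), qprimeIter_one_const hL] at hQ0
  have hF0 : F 0 = 0 := eq_zero_of_conjR_eq_zero _ hQ0
  apply Subtype.ext
  funext x
  rw [hfF x, hconst x, hF0, Submodule.coe_zero, Pi.zero_apply]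
  simp [conjR]

/-- ★★ **THM 3.11, FIRST CLAUSE, AT EVERY FLAT PERIODIC BACKGROUND — POSITIVITY**: under the same hypotheses `⟨f, Δ′_a(U₁)f⟩ > 0` for `f ≠ 0` on
`L²(T_P, ·)`. [cite: Balaban1985BackgroundPropagators, Thm 3.11 p.416, (3.24) p.394] -/
theorem formPer_deltaPrimeAPer_self_pos_of_flat (hη : η ≠ 0) (hL : 1 ≤ L) (hτt : ∀ a b : 𝔸, τ (a * b) = τ (b * a))
    (hτp : ∀ a : 𝔸, a ≠ 0 → 0 < (τ (star a * a)).re)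
    (hP : L ^ m ∣ P) (ha : ∀ j, 0 ≤ a j) {j₀ : ℕ} (hj₀ : j₀ ≤ m) (haj₀ : 0 < a j₀)
    (hΛ₀ : IsPeriodic (P / L ^ j₀) fun y => y ∈ Λs j₀) (hne : (Λs j₀).Nonempty)
    {U₁ : Site d → Fin d → 𝔸ˣ} (hU₁ : ∀ x κ, U₁ x κ ∈ unitaryUnits 𝔸) (hU : IsPeriodic P U₁)
    (hflat : ∀ (κ ν : Fin d) (x : Site d), plaqF U₁ κ ν x = 1) {f : perSub (𝔸 := 𝔸) (d := d) P} (hf : f ≠ 0) :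
    0 < formPer τ P f (deltaPrimeAPer L U₁ η m a Λs P f) := by
  have hT : ∀ (j : ℕ) (z y : Site d), bgT L U₁ j z y ∈ unitaryUnits 𝔸 := bgT_mem_unitaryUnits_of_flat L hU₁ hflat
  have hnn := formPer_deltaPrimeAPer_self_nonneg τ hτt hτp hU₁ hT hU hP ha f (η := η) (Λs := Λs)
  rcases hnn.lt_or_eq with hlt | heq
  · exact hlt
  · exact absurd (eq_zero_of_formPer_deltaPrimeAPer_eq_zero_of_flat τ hη hL hτt hτp hP ha hj₀ haj₀ hΛ₀ hne hU₁ hU hflat heq.symm) hf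

/-- ★★ **THM 3.11, FIRST CLAUSE, AT EVERY FLAT PERIODIC BACKGROUND — `Δ′_a(U₁)` IS INVERTIBLE ON `L²(T_P, ·)`** (`RegularPrimePer`; finite-dimensional fibre).
[cite: Balaban1985BackgroundPropagators, Thm 3.11 p.416, (3.24) p.394 («Its inverse is denoted by G′, or G′(U)»)] -/
theorem regularPrimePer_of_flat [FiniteDimensional ℝ 𝔸] (hη : η ≠ 0) (hL : 1 ≤ L) (hτt : ∀ a b : 𝔸, τ (a * b) = τ (b * a))
    (hτp : ∀ a : 𝔸, a ≠ 0 → 0 < (τ (star a * a)).re)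
    (hP : L ^ m ∣ P) (ha : ∀ j, 0 ≤ a j) {j₀ : ℕ} (hj₀ : j₀ ≤ m) (haj₀ : 0 < a j₀)
    (hΛ₀ : IsPeriodic (P / L ^ j₀) fun y => y ∈ Λs j₀) (hne : (Λs j₀).Nonempty)
    {U₁ : Site d → Fin d → 𝔸ˣ} (hU₁ : ∀ x κ, U₁ x κ ∈ unitaryUnits 𝔸) (hU : IsPeriodic P U₁)
    (hflat : ∀ (κ ν : Fin d) (x : Site d), plaqF U₁ κ ν x = 1) : RegularPrimePer L U₁ η m a Λs P :=
  bijective_of_form_pos τ fun _ hf => formPer_deltaPrimeAPer_self_pos_of_flat τ hη hL hτt hτp hP ha hj₀ haj₀ hΛ₀ hne hU₁ hU hflat hf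

end Scalar

/-! ## §3  The engine re-based at a general base point `U₁` -/

section Base

variable [FiniteDimensional ℝ 𝔸] [Nontrivial 𝔸] (τ : 𝔸 →ₗ[ℂ] ℂ) (hτp : ∀ a : 𝔸, a ≠ 0 → 0 < (τ (star a * a)).re)
  (hτt : ∀ a b : 𝔸, τ (a * b) = τ (b * a)) (hτs : ∀ a : 𝔸, τ (star a) = starRingEnd ℂ (τ a)) {L P : ℕ} [NeZero P] [NeZero L]

omit [Nontrivial 𝔸] [NeZero L] in
/-- ★★ **THE SCALAR REGIME IS OPEN AT ANY ADMISSIBLE BASE POINT**: if the loop variables `Ūⁱ_{U₁}(Γ_{c,x})Ūⁱ_{U₁}(c)⁻¹`, `i < m + 1`, lie in the disc of (21)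
and `⟨f, Δ′_a(U₁)f⟩_{T_P} > 0` on `L²(T_P) ∖ 0`, then `⟨f, Δ′_a(U₀)f⟩_{T_P} > 0` on `L²(T_P) ∖ 0` — hence `Δ′_a(U₀)` invertible — for ALL `U₀` NEAR `U₁` within
any set `𝒰` (dag-n06-w4's `regularPrimePer_eventually_one` with the base point freed).
[cite: Balaban1985BackgroundPropagators, Thm 3.11 p.416 («Δ′_a, G′ … positive definite»), (3.24) p.394] -/
theorem regularPrimePer_eventually_of_base {η : ℝ} {m : ℕ} {a : ℕ → ℝ} {Λs : ℕ → Set (Site d)} {U₁ : Site d → Fin d → 𝔸ˣ}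
    (hsmall : ∀ i, i < m + 1 → ∀ (q : Site d) (κ : Fin d) (r : Fin d → Fin L),
      ‖((Wcx L (avgIter L U₁ i) q κ (boxVec L r) : 𝔸ˣ) : 𝔸) - 1‖ < 1)
    (hposS : ∀ f : perSub (𝔸 := 𝔸) (d := d) P, f ≠ 0 → 0 < formPer τ P f (deltaPrimeAPer L U₁ η m a Λs P f))
    (𝒰 : Set (Site d → Fin d → 𝔸ˣ)) :
    ∀ᶠ U₀ in 𝓝[𝒰] U₁,
      (∀ f : perSub (𝔸 := 𝔸) (d := d) P, f ≠ 0 → 0 < formPer τ P f (deltaPrimeAPer L U₀ η m a Λs P f)) ∧ RegularPrimePer L U₀ η m a Λs P := by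
  haveI := finiteDimensional_perSub (𝔸 := 𝔸) (d := d) P
  -- the bilinear forms `q U (f, g) = ⟨f, Δ′_a(U) g⟩`
  let q : (Site d → Fin d → 𝔸ˣ) → perSub (𝔸 := 𝔸) (d := d) P →ₗ[ℝ] perSub (𝔸 := 𝔸) (d := d) P →ₗ[ℝ] ℝ := fun U =>
    (formPer τ P).compl₂ (deltaPrimeAPer L U η m a Λs P)
  have hq : ∀ U (f g : perSub (𝔸 := 𝔸) (d := d) P), q U f g = formPer τ P f (deltaPrimeAPer L U η m a Λs P g) := fun U f g => rfl
  -- continuity of the entries at `U₁` (the averaged transporters are continuous there)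
  have hbgT : ∀ j, j < m + 1 → ∀ (y x : Site d), ContinuousAt (fun U₀ : Site d → Fin d → 𝔸ˣ => bgT L U₀ j y x) U₁ :=
    fun j hj y x => continuousAt_bgT L continuousAt_id j (fun i hi q κ r => hsmall i (hi.trans hj) q κ r) y x
  have hcq : ∀ f g : perSub (𝔸 := 𝔸) (d := d) P, ContinuousWithinAt (fun U => q U f g) 𝒰 U₁ := by
    intro f g
    have hΔ : ContinuousAt (fun U₀ : Site d → Fin d → 𝔸ˣ => deltaPrimeAPer L U₀ η m a Λs P g) U₁ :=
      continuousAt_deltaPrimeAPer (U := fun U₀ : Site d → Fin d → 𝔸ˣ => U₀) continuousAt_id hbgT η a continuousAt_const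
    have hφ : Continuous fun v : perSub (𝔸 := 𝔸) (d := d) P => formPer τ P f v := (formPer τ P f).continuous_of_finiteDimensional
    exact (hφ.continuousAt.comp hΔ).continuousWithinAt
  have hposq : ∀ f : perSub (𝔸 := 𝔸) (d := d) P, f ≠ 0 → 0 < q U₁ f f := fun f hf => hposS f hf
  have hev := posDef_eventually_of_continuousWithinAt q 𝒰 U₁ hcq hposq
  filter_upwards [hev] with U hU
  exact ⟨hU, bijective_of_form_pos τ hU⟩

include hτp hτt hτs in
/-- ★★ **ALL FOUR LETTERS OF THE GENUINE PERIODIC `Δ_a(U₀)` ARE CONTINUOUS IN THE BACKGROUND, WITHIN THE REGIME SET, AT ANY BASE POINT `U₁ ∈ 𝒰` WHOSE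
AVERAGED LOOP VARIABLES LIE IN THE DISC**, on `E_𝔤^per(P)` (dag-n06-w4's `lettersContinuousWithinAt_opsAllZdPer_one` with the base point freed: member
`(M, i, m)` with `Lᵐ ∣ P`, level-periodic `i.Λs m j`, `1 ≤ L`; regime set `𝒰 ∋ U₁` of unitary `P`-periodic backgrounds in the `Reg17` class with `Ū₀ʲ(Γ)`
unitary for `j ≤ m`, scalar regime `RegularPrimePer` and `Q′*` injective on `𝒰`).
[cite: Balaban1985BackgroundPropagators, (3.26) p.395, (3.10) p.392, (3.16) p.393, (3.20)–(3.25) p.394; Balaban1985RegularSpaces, (1.7) p.77, p.77 («Ω_j = T_η»)] -/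
theorem lettersContinuousWithinAt_opsAllZdPer_of_base (ΛbP : ℕ → ℕ → Set (Site d × Fin d)) (ops₀ : ℝ → ZdIdx d L → ℕ → OpsZd d 𝔸) (M : ℝ)
    (i : ZdIdx d L) (m : ℕ) (a : ℕ → ℝ) (hL : 1 ≤ L) (hP : L ^ m ∣ P) (hΛ : ∀ j, j ≤ m → IsPeriodic (P / L ^ j) fun y => y ∈ i.Λs m j)
    {𝒰 : Set (Site d → Fin d → 𝔸ˣ)} {U₁ : Site d → Fin d → 𝔸ˣ} (h1 : U₁ ∈ 𝒰)
    (hsmall : ∀ i', i' < m + 1 → ∀ (q : Site d) (κ : Fin d) (r : Fin d → Fin L),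
      ‖((Wcx L (avgIter L U₁ i') q κ (boxVec L r) : 𝔸ˣ) : 𝔸) - 1‖ < 1)
    (hunit : ∀ U₀ ∈ 𝒰, ∀ (x : Site d) (κ : Fin d), U₀ x κ ∈ unitaryUnits 𝔸) (hper : ∀ U₀ ∈ 𝒰, IsPeriodic P U₀)
    (hreg : ∀ U₀ ∈ 𝒰, Reg17 L m i.Ω (alphaQ d L / (L : ℝ) ^ 2) U₀)
    (hT : ∀ U₀ ∈ 𝒰, ∀ j, j ≤ m → ∀ (x y : Site d), bgT L U₀ j x y ∈ unitaryUnits 𝔸)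
    (hregP : ∀ U₀ ∈ 𝒰, RegularPrimePer L U₀ i.η m a (i.Λs m) P) (hinj : ∀ U₀ ∈ 𝒰, QprimeStarPerInjective (𝔸 := 𝔸) (d := d) P L U₀ m (i.Λs m))
    {A : Site d → Fin d → 𝔸} (hA : A ∈ domSubHPer (d := d) (𝔸 := 𝔸) P) (y : Site d) (μ : Fin d) :
    ContinuousWithinAt (fun U₀ => deltaAOf i.η (opsAllZdPer τ L P ΛbP ops₀ M i m) U₀ A y μ) 𝒰 U₁ := by
  have hAp : IsPeriodic P A := ((mem_domSubHPer_iff P A).1 hA).1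
  have hAh : ∀ (w : Site d) (κ : Fin d), IsSelfAdjoint (A w κ) := ((mem_domSubHPer_iff P A).1 hA).2
  -- the `D R^per D*` letter: continuity on the subtype `𝒰` at `⟨U₁, h1⟩`
  have h3 : ContinuousWithinAt
      (fun U₀ => B8Ineq132.covDerivFwd i.η U₀ μ (B9Eq321LandauProjectionZdPer.projRPer τ P L m i.η (i.Λs m) U₀ (B8Eq138LandauZd.covDivB i.η U₀ A)) y) 𝒰 U₁ := by
    rw [continuousWithinAt_iff_continuousAt_restrict _ h1]
    have hval : ContinuousAt (fun z : 𝒰 => (z : Site d → Fin d → 𝔸ˣ)) ⟨U₁, h1⟩ := continuous_subtype_val.continuousAt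
    have hbgT : ∀ j, j < m + 1 → ∀ (y' x' : Site d), ContinuousAt (fun z : 𝒰 => bgT L (z : Site d → Fin d → 𝔸ˣ) j y' x') ⟨U₁, h1⟩ :=
      fun j hj y' x' => continuousAt_bgT L hval j (fun i' hi' q κ r => hsmall i' (hi'.trans hj) q κ r) y' x'
    exact continuousAt_covDerivFwd_projRPer_covDivB_le τ i.η a hval hbgT hτt hτs hτp hL (fun z => hunit z.1 z.2) (fun z => hT z.1 z.2)
      (fun z => hper z.1 z.2) hP hΛ (fun z => hregP z.1 z.2) (fun z => hinj z.1 z.2) hAp hAh μ y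
  -- the `Q*aQ` letter: the regime branch is continuous at `U₁`, and the total letter agrees with it on `𝒰`
  have h4 : ContinuousWithinAt (fun U₀ => QQZdP τ L ΛbP i m U₀ A y μ) 𝒰 U₁ := by
    have hb : ContinuousAt (fun U₀ : Site d → Fin d → 𝔸ˣ =>
        ∑ j ∈ Finset.range (m + 1), (B9Eq316AveragingTransposeZd.wQ (d := d) L i.η j) •
          B9Eq316AveragingTransposeZd.linCovIterT τ L U₀ j (B9Eq316AveragingTransposeZd.clsField L ΛbP i.η m j U₀ A) y μ) U₁ :=
      continuousAt_QQZdP_branch τ L continuousAt_id ΛbP i m (fun i' hi' q κ r => hsmall i' (Nat.lt_succ_of_lt hi') q κ r) A y μ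
    refine (hb.continuousWithinAt (s := 𝒰)).congr (fun U₀ hU₀ => ?_) ?_
    · show QQZdP τ L ΛbP i m U₀ A y μ = _
      unfold QQZdP
      rw [if_pos (hreg U₀ hU₀)]
    · show QQZdP τ L ΛbP i m U₁ A y μ = _
      unfold QQZdP
      rw [if_pos (hreg U₁ h1)]
  have h12 := B9Eq310DeltaPrimeContinuityZd.continuousWithinAt_Jcur_add_DpZd i.η A y μ 𝒰 U₁
  have h := (h12.add h3).add h4
  refine h.congr (fun U₀ _ => ?_) ?_ <;> simp only [deltaAOf_opsAllZdPer_apply, Pi.add_apply]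

include hτp hτt hτs in
/-- ★★★ **THEOREM 3.11's POSITIVITY ON THE TORUS, NEAR ANY ADMISSIBLE BASE POINT, FOR THE GENUINE PERIODIC RECORD.**  Member `(M, i, m)` with `η ≠ 0`,
`2 ≤ L`, `Lᵐ ∣ P`, level-periodic constraint sets with `i.Λs m j₀ ≠ ∅` for some `j₀ ≤ m`, the box law of the `Q*aQ` class; regime set `𝒰 ∋ U₁` of unitary
`P`-periodic backgrounds in the `Reg17` class with `Ū₀ʲ(Γ)` unitary for `j ≤ m` and `Q′*` injective; base-point facts at `U₁`: the disc condition on the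
averaged loop variables, the scalar positivity `⟨f, Δ′_a(U₁)f⟩ > 0` (weights `a ≡ 1`), and the record's positivity `⟨A, Δ_a(U₁)A⟩_per > 0` on
`E_𝔤^per(P) ∖ 0`.  THEN `⟨A, Δ_a(U₀)A⟩_per > 0` on `E_𝔤^per(P) ∖ 0` for ALL `U₀ ∈ 𝒰` NEAR `U₁`.
[cite: Balaban1985BackgroundPropagators, Thm 3.11 p.416, (3.26) p.395; Balaban1985RegularSpaces, (1.7) p.77, p.77 («Ω_j = T_η»)] -/
theorem bondPairPer_pos_eventually_opsAllZdPer_of_base (hL2 : 2 ≤ L) (ΛbP : ℕ → ℕ → Set (Site d × Fin d))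
    (ops₀ : ℝ → ZdIdx d L → ℕ → OpsZd d 𝔸) (M : ℝ) (i : ZdIdx d L) (m : ℕ) (hP : L ^ m ∣ P)
    (hΛ : ∀ j, j ≤ m → IsPeriodic (P / L ^ j) fun y => y ∈ i.Λs m j)
    (hbox : ∀ j, 1 ≤ j → j ≤ m → ∀ c ∈ ΛbP m j, ∀ x, InBox (loK L j c.1) (bondHiK L j c.1 c.2) x → x ∈ i.Ω (j - 1))
    {𝒰 : Set (Site d → Fin d → 𝔸ˣ)} {U₁ : Site d → Fin d → 𝔸ˣ} (h1 : U₁ ∈ 𝒰)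
    (hsmall : ∀ i', i' < m + 1 → ∀ (q : Site d) (κ : Fin d) (r : Fin d → Fin L),
      ‖((Wcx L (avgIter L U₁ i') q κ (boxVec L r) : 𝔸ˣ) : 𝔸) - 1‖ < 1)
    (hposS : ∀ f : perSub (𝔸 := 𝔸) (d := d) P, f ≠ 0 → 0 < formPer τ P f (deltaPrimeAPer L U₁ i.η m (fun _ => (1 : ℝ)) (i.Λs m) P f))
    (hunit : ∀ U₀ ∈ 𝒰, ∀ (x : Site d) (κ : Fin d), U₀ x κ ∈ unitaryUnits 𝔸) (hper : ∀ U₀ ∈ 𝒰, IsPeriodic P U₀)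
    (hreg : ∀ U₀ ∈ 𝒰, Reg17 L m i.Ω (alphaQ d L / (L : ℝ) ^ 2) U₀)
    (hT : ∀ U₀ ∈ 𝒰, ∀ j, j ≤ m → ∀ (x y : Site d), bgT L U₀ j x y ∈ unitaryUnits 𝔸)
    (hinj : ∀ U₀ ∈ 𝒰, QprimeStarPerInjective (𝔸 := 𝔸) (d := d) P L U₀ m (i.Λs m))
    (hposU₁ : ∀ A ∈ domSubHPer (d := d) (𝔸 := 𝔸) P, A ≠ 0 → 0 < bondPairPer τ P A (deltaAOf i.η (opsAllZdPer τ L P ΛbP ops₀ M i m) U₁ A)) :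
    ∀ᶠ U₀ in 𝓝[𝒰] U₁,
      ∀ A ∈ domSubHPer (d := d) (𝔸 := 𝔸) P, A ≠ 0 → 0 < bondPairPer τ P A (deltaAOf i.η (opsAllZdPer τ L P ΛbP ops₀ M i m) U₀ A) := by
  have hL : 1 ≤ L := le_trans (by norm_num) hL2
  set a : ℕ → ℝ := fun _ => 1 with ha
  -- the scalar regime holds on a `𝓝[𝒰] U₁`-large set; restrict `𝒰` to it
  have hR := regularPrimePer_eventually_of_base τ hsmall hposS 𝒰 (η := i.η) (a := a) (Λs := i.Λs m)
  set T : Set (Site d → Fin d → 𝔸ˣ) := {U₀ | RegularPrimePer L U₀ i.η m a (i.Λs m) P} with hTdef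
  have hTmem : T ∈ 𝓝[𝒰] U₁ := hR.mono fun U hU => hU.2
  have h1T : U₁ ∈ 𝒰 ∩ T := ⟨h1, bijective_of_form_pos τ hposS⟩
  -- the engine on `𝒰 ∩ T`
  have hlin : ∀ U₀ ∈ 𝒰 ∩ T, LinearOnDomAt i.η (opsAllZdPer τ L P ΛbP ops₀ M i m) (Set.univ : Set (Site d)) U₀ :=
    fun U₀ hU₀ => linearOnDomAt_opsAllZdPer_univ τ P hL2 ΛbP ops₀ M i m hbox (hunit U₀ hU₀.1)
  have hcont : ∀ A ∈ domSubHPer (d := d) (𝔸 := 𝔸) P, ∀ (y : Site d) (μ : Fin d),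
      ContinuousWithinAt (fun U₀ => deltaAOf i.η (opsAllZdPer τ L P ΛbP ops₀ M i m) U₀ A y μ) (𝒰 ∩ T) U₁ :=
    fun A hA y μ => lettersContinuousWithinAt_opsAllZdPer_of_base τ hτp hτt hτs ΛbP ops₀ M i m a hL hP hΛ h1T
      (fun i' hi' q κ r => hsmall i' hi' q κ r) (fun U hU => hunit U hU.1)
      (fun U hU => hper U hU.1) (fun U hU => hreg U hU.1) (fun U hU => hT U hU.1) (fun U hU => hU.2) (fun U hU => hinj U hU.1) hA y μ
  have hev := bondPairPer_pos_eventually_domSubHPer τ h1T hlin hcont hposU₁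
  rwa [nhdsWithin_inter_of_mem' hTmem] at hev

include hτp hτt hτs in
/-- ★★★ **(3.27) ON THE TORUS NEAR ANY ADMISSIBLE BASE POINT: `G_𝔤^per(U₀) = (Δ_a(U₀))⁻¹` EXISTS FOR THE GENUINE RECORD** — under the hypotheses of
`bondPairPer_pos_eventually_opsAllZdPer_of_base` (plus the level-periodic class sections `ΛbP` of the `Q*aQ` letter), `RegularAtHPer i.η (opsAllZdPer …) P U₀`
for all `U₀ ∈ 𝒰` near `U₁` (the lineage's `regularAtHPer_opsAllZdPer_of_pos` door, pointwise).
[cite: Balaban1985BackgroundPropagators, Thm 3.11 p.416, (3.26)–(3.27) p.395; Balaban1985RegularSpaces, (1.58) p.86, p.77 («Ω_j = T_η»)] -/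
theorem regularAtHPer_eventually_opsAllZdPer_of_base (hL2 : 2 ≤ L) (ΛbP : ℕ → ℕ → Set (Site d × Fin d))
    (ops₀ : ℝ → ZdIdx d L → ℕ → OpsZd d 𝔸) (M : ℝ) (i : ZdIdx d L) (m : ℕ) (hP : L ^ m ∣ P)
    (hΛ : ∀ j, j ≤ m → IsPeriodic (P / L ^ j) fun y => y ∈ i.Λs m j)
    (hΛb : ∀ j, j ≤ m → ∀ κ : Fin d, IsPeriodic (P / L ^ j) (fun z => (z, κ) ∈ ΛbP m j))
    (hbox : ∀ j, 1 ≤ j → j ≤ m → ∀ c ∈ ΛbP m j, ∀ x, InBox (loK L j c.1) (bondHiK L j c.1 c.2) x → x ∈ i.Ω (j - 1))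
    {𝒰 : Set (Site d → Fin d → 𝔸ˣ)} {U₁ : Site d → Fin d → 𝔸ˣ} (h1 : U₁ ∈ 𝒰)
    (hsmall : ∀ i', i' < m + 1 → ∀ (q : Site d) (κ : Fin d) (r : Fin d → Fin L),
      ‖((Wcx L (avgIter L U₁ i') q κ (boxVec L r) : 𝔸ˣ) : 𝔸) - 1‖ < 1)
    (hposS : ∀ f : perSub (𝔸 := 𝔸) (d := d) P, f ≠ 0 → 0 < formPer τ P f (deltaPrimeAPer L U₁ i.η m (fun _ => (1 : ℝ)) (i.Λs m) P f))
    (hunit : ∀ U₀ ∈ 𝒰, ∀ (x : Site d) (κ : Fin d), U₀ x κ ∈ unitaryUnits 𝔸) (hper : ∀ U₀ ∈ 𝒰, IsPeriodic P U₀)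
    (hreg : ∀ U₀ ∈ 𝒰, Reg17 L m i.Ω (alphaQ d L / (L : ℝ) ^ 2) U₀)
    (hT : ∀ U₀ ∈ 𝒰, ∀ j, j ≤ m → ∀ (x y : Site d), bgT L U₀ j x y ∈ unitaryUnits 𝔸)
    (hinj : ∀ U₀ ∈ 𝒰, QprimeStarPerInjective (𝔸 := 𝔸) (d := d) P L U₀ m (i.Λs m))
    (hposU₁ : ∀ A ∈ domSubHPer (d := d) (𝔸 := 𝔸) P, A ≠ 0 → 0 < bondPairPer τ P A (deltaAOf i.η (opsAllZdPer τ L P ΛbP ops₀ M i m) U₁ A)) :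
    ∀ᶠ U₀ in 𝓝[𝒰] U₁, RegularAtHPer i.η (opsLandauPer τ P (withDpZd (withQQP τ L ΛbP ops₀)) M i m) P U₀ := by
  have hev := bondPairPer_pos_eventually_opsAllZdPer_of_base τ hτp hτt hτs hL2 ΛbP ops₀ M i m hP hΛ hbox h1 hsmall hposS hunit hper hreg hT hinj hposU₁
  filter_upwards [hev, eventually_mem_nhdsWithin] with U₀ hU₀ hU𝒰
  exact regularAtHPer_opsAllZdPer_of_pos τ P hL2 hτp hτt hτs ΛbP ops₀ M i (hunit U₀ hU𝒰) (hper U₀ hU𝒰) hP hΛb hbox hU₀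

end Base

/-! ## §4  At a flat base point: the three base-point facts discharged -/

section FlatBase

variable [FiniteDimensional ℝ 𝔸] [Nontrivial 𝔸] (τ : 𝔸 →ₗ[ℂ] ℂ) (hτp : ∀ a : 𝔸, a ≠ 0 → 0 < (τ (star a * a)).re)
  (hτt : ∀ a b : 𝔸, τ (a * b) = τ (b * a)) (hτs : ∀ a : 𝔸, τ (star a) = starRingEnd ℂ (τ a)) {L P : ℕ} [NeZero P] [NeZero L]

include hτp hτt hτs in
/-- ★★★ **THEOREM 3.11's POSITIVITY ON THE TORUS NEAR EVERY FLAT PERIODIC BACKGROUND (ANY HOLONOMY) FOR THE GENUINE RECORD.**  Member `(M, i, m)` with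
`2 ≤ L`, `Lᵐ ∣ P`, level-periodic constraint sets with `i.Λs m j₀ ≠ ∅` for some `j₀ ≤ m`, box law; regime set `𝒰` of unitary `P`-periodic backgrounds in the
`Reg17` class with `Ū₀ʲ(Γ)` unitary for `j ≤ m` and `Q′*` injective, containing the FLAT unitary `P`-periodic `U₁` (plaquette variables `≡ 1`); faithful
Hermitian tracial `τ`, finite-dimensional fibre.  IF `⟨A, Δ_a(U₁)A⟩_per > 0` on `E_𝔤^per(P) ∖ 0` THEN `⟨A, Δ_a(U₀)A⟩_per > 0` there for ALL `U₀ ∈ 𝒰` NEAR `U₁`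
— the disc condition (§1) and the scalar positivity (§2) at `U₁` are theorems. [cite: Balaban1985BackgroundPropagators, Thm 3.11 p.416, (3.26) p.395; Balaban1985RegularSpaces, (1.7) p.77, p.77 («Ω_j = T_η»)] -/
theorem bondPairPer_pos_eventually_opsAllZdPer_of_flat (hL2 : 2 ≤ L) (ΛbP : ℕ → ℕ → Set (Site d × Fin d))
    (ops₀ : ℝ → ZdIdx d L → ℕ → OpsZd d 𝔸) (M : ℝ) (i : ZdIdx d L) (m : ℕ) (hP : L ^ m ∣ P)
    (hΛ : ∀ j, j ≤ m → IsPeriodic (P / L ^ j) fun y => y ∈ i.Λs m j) {j₀ : ℕ} (hj₀ : j₀ ≤ m) (hne : (i.Λs m j₀).Nonempty)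
    (hbox : ∀ j, 1 ≤ j → j ≤ m → ∀ c ∈ ΛbP m j, ∀ x, InBox (loK L j c.1) (bondHiK L j c.1 c.2) x → x ∈ i.Ω (j - 1))
    {𝒰 : Set (Site d → Fin d → 𝔸ˣ)} {U₁ : Site d → Fin d → 𝔸ˣ} (h1 : U₁ ∈ 𝒰)
    (hU₁ : ∀ x κ, U₁ x κ ∈ unitaryUnits 𝔸) (hU₁per : IsPeriodic P U₁) (hflat : ∀ (κ ν : Fin d) (x : Site d), plaqF U₁ κ ν x = 1)
    (hunit : ∀ U₀ ∈ 𝒰, ∀ (x : Site d) (κ : Fin d), U₀ x κ ∈ unitaryUnits 𝔸) (hper : ∀ U₀ ∈ 𝒰, IsPeriodic P U₀)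
    (hreg : ∀ U₀ ∈ 𝒰, Reg17 L m i.Ω (alphaQ d L / (L : ℝ) ^ 2) U₀)
    (hT : ∀ U₀ ∈ 𝒰, ∀ j, j ≤ m → ∀ (x y : Site d), bgT L U₀ j x y ∈ unitaryUnits 𝔸)
    (hinj : ∀ U₀ ∈ 𝒰, QprimeStarPerInjective (𝔸 := 𝔸) (d := d) P L U₀ m (i.Λs m))
    (hposU₁ : ∀ A ∈ domSubHPer (d := d) (𝔸 := 𝔸) P, A ≠ 0 → 0 < bondPairPer τ P A (deltaAOf i.η (opsAllZdPer τ L P ΛbP ops₀ M i m) U₁ A)) :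
    ∀ᶠ U₀ in 𝓝[𝒰] U₁,
      ∀ A ∈ domSubHPer (d := d) (𝔸 := 𝔸) P, A ≠ 0 → 0 < bondPairPer τ P A (deltaAOf i.η (opsAllZdPer τ L P ΛbP ops₀ M i m) U₀ A) := by
  have hL : 1 ≤ L := le_trans (by norm_num) hL2
  refine bondPairPer_pos_eventually_opsAllZdPer_of_base τ hτp hτt hτs hL2 ΛbP ops₀ M i m hP hΛ hbox h1
    (fun i' _ q κ r => norm_Wcx_avgIter_sub_one_lt_one_of_flat L hU₁ hflat i' q κ r) (fun f hf => ?_) hunit hper hreg hT hinj hposU₁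
  exact formPer_deltaPrimeAPer_self_pos_of_flat τ i.hη.ne' hL hτt hτp hP (fun _ => zero_le_one) hj₀ zero_lt_one (hΛ j₀ hj₀) hne hU₁ hU₁per
    hflat hf

include hτp hτt hτs in
/-- ★★★ **(3.27) ON THE TORUS NEAR EVERY FLAT PERIODIC BACKGROUND: `G_𝔤^per(U₀) = (Δ_a(U₀))⁻¹` EXISTS FOR THE GENUINE RECORD** — under the hypotheses of
`bondPairPer_pos_eventually_opsAllZdPer_of_flat` (plus the level-periodic class sections `ΛbP`), `RegularAtHPer` for all `U₀ ∈ 𝒰` near `U₁`.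
[cite: Balaban1985BackgroundPropagators, Thm 3.11 p.416, (3.26)–(3.27) p.395; Balaban1985RegularSpaces, (1.58) p.86, p.77 («Ω_j = T_η»)] -/
theorem regularAtHPer_eventually_opsAllZdPer_of_flat (hL2 : 2 ≤ L) (ΛbP : ℕ → ℕ → Set (Site d × Fin d))
    (ops₀ : ℝ → ZdIdx d L → ℕ → OpsZd d 𝔸) (M : ℝ) (i : ZdIdx d L) (m : ℕ) (hP : L ^ m ∣ P)
    (hΛ : ∀ j, j ≤ m → IsPeriodic (P / L ^ j) fun y => y ∈ i.Λs m j) {j₀ : ℕ} (hj₀ : j₀ ≤ m) (hne : (i.Λs m j₀).Nonempty)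
    (hΛb : ∀ j, j ≤ m → ∀ κ : Fin d, IsPeriodic (P / L ^ j) (fun z => (z, κ) ∈ ΛbP m j))
    (hbox : ∀ j, 1 ≤ j → j ≤ m → ∀ c ∈ ΛbP m j, ∀ x, InBox (loK L j c.1) (bondHiK L j c.1 c.2) x → x ∈ i.Ω (j - 1))
    {𝒰 : Set (Site d → Fin d → 𝔸ˣ)} {U₁ : Site d → Fin d → 𝔸ˣ} (h1 : U₁ ∈ 𝒰)
    (hU₁ : ∀ x κ, U₁ x κ ∈ unitaryUnits 𝔸) (hU₁per : IsPeriodic P U₁) (hflat : ∀ (κ ν : Fin d) (x : Site d), plaqF U₁ κ ν x = 1)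
    (hunit : ∀ U₀ ∈ 𝒰, ∀ (x : Site d) (κ : Fin d), U₀ x κ ∈ unitaryUnits 𝔸) (hper : ∀ U₀ ∈ 𝒰, IsPeriodic P U₀)
    (hreg : ∀ U₀ ∈ 𝒰, Reg17 L m i.Ω (alphaQ d L / (L : ℝ) ^ 2) U₀)
    (hT : ∀ U₀ ∈ 𝒰, ∀ j, j ≤ m → ∀ (x y : Site d), bgT L U₀ j x y ∈ unitaryUnits 𝔸)
    (hinj : ∀ U₀ ∈ 𝒰, QprimeStarPerInjective (𝔸 := 𝔸) (d := d) P L U₀ m (i.Λs m))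
    (hposU₁ : ∀ A ∈ domSubHPer (d := d) (𝔸 := 𝔸) P, A ≠ 0 → 0 < bondPairPer τ P A (deltaAOf i.η (opsAllZdPer τ L P ΛbP ops₀ M i m) U₁ A)) :
    ∀ᶠ U₀ in 𝓝[𝒰] U₁, RegularAtHPer i.η (opsLandauPer τ P (withDpZd (withQQP τ L ΛbP ops₀)) M i m) P U₀ := by
  have hev := bondPairPer_pos_eventually_opsAllZdPer_of_flat τ hτp hτt hτs hL2 ΛbP ops₀ M i m hP hΛ hj₀ hne hbox h1 hU₁ hU₁per hflat hunit hper
    hreg hT hinj hposU₁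
  filter_upwards [hev, eventually_mem_nhdsWithin] with U₀ hU₀ hU𝒰
  exact regularAtHPer_opsAllZdPer_of_pos τ P hL2 hτp hτt hτs ΛbP ops₀ M i (hunit U₀ hU𝒰) (hper U₀ hU𝒰) hP hΛb hbox hU₀

end FlatBase

/-! ## §5  At the torus member of record `torusIdx`: no displayed binder -/

section TorusMember

open B8Thm4TorusAt (torusLam mem_torusLam_iff torusLam_self)
open B8Thm2TorusMember (TorusMember torusIdx torusLamb)

variable [FiniteDimensional ℝ 𝔸] [Nontrivial 𝔸] (τ : 𝔸 →ₗ[ℂ] ℂ) (hτp : ∀ a : 𝔸, a ≠ 0 → 0 < (τ (star a * a)).re)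
  (hτt : ∀ a b : 𝔸, τ (a * b) = τ (b * a)) (hτs : ∀ a : 𝔸, τ (star a) = starRingEnd ℂ (τ a)) {L P : ℕ} [NeZero P] [NeZero L]

include hτp hτt hτs in
/-- ★★★★ **THM 3.11 ∕ (3.27) AT THE TORUS MEMBER `torusIdx`, NEAR EVERY FLAT PERIODIC BACKGROUND (ANY HOLONOMY)** (`Ω_j = ℤᵈ`, constraint sets `torusLam m`,
constraint bonds `torusLamb`): the level-periodicity, non-emptiness, `Q′*`-injectivity (one active level) and box-law hypotheses hold with NO condition,
and the positivity of the genuine periodic `Δ_a(U₁)` on `E_𝔤^per(P)` at the flat `U₁` is dag-n06-b g23's `B9Thm311FlatHolonomyKernelZdPer` theorem, cited BY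
NAME — so for every flat unitary `P`-periodic `U₁ ∈ 𝒰` (regime set as in §4: unitary, `P`-periodic, `Reg17`, `Ū₀ʲ(Γ)` unitary for `j ≤ m`), `RegularAtHPer`
for the genuine record at `torusIdx` holds for all `U₀ ∈ 𝒰` NEAR `U₁`; `2 ≤ L`, `Lᵐ ∣ P`.
[cite: Balaban1985BackgroundPropagators, Thm 3.11 p.416, (3.26)–(3.27) p.395; Balaban1985RegularSpaces, (1.28) p.81, (1.37) p.82, p.77 («Ω_j = T_η»)] -/
theorem regularAtHPer_eventually_torusIdx_of_flat (hL2 : 2 ≤ L) (t : TorusMember) (ops₀ : ℝ → ZdIdx d L → ℕ → OpsZd d 𝔸) (M : ℝ) (m : ℕ)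
    (hP : L ^ m ∣ P) {𝒰 : Set (Site d → Fin d → 𝔸ˣ)} {U₁ : Site d → Fin d → 𝔸ˣ} (h1 : U₁ ∈ 𝒰)
    (hU₁ : ∀ x κ, U₁ x κ ∈ unitaryUnits 𝔸) (hU₁per : IsPeriodic P U₁) (hflat : ∀ (κ ν : Fin d) (x : Site d), plaqF U₁ κ ν x = 1)
    (hunit : ∀ U₀ ∈ 𝒰, ∀ (x : Site d) (κ : Fin d), U₀ x κ ∈ unitaryUnits 𝔸) (hper : ∀ U₀ ∈ 𝒰, IsPeriodic P U₀)
    (hreg : ∀ U₀ ∈ 𝒰, Reg17 L m (torusIdx (d := d) (le_trans (by norm_num) hL2) t).Ω (alphaQ d L / (L : ℝ) ^ 2) U₀)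
    (hT : ∀ U₀ ∈ 𝒰, ∀ j, j ≤ m → ∀ (x y : Site d), bgT L U₀ j x y ∈ unitaryUnits 𝔸) :
    ∀ᶠ U₀ in 𝓝[𝒰] U₁,
      RegularAtHPer t.η (opsLandauPer τ P (withDpZd (withQQP τ L (fun m => torusLamb m) ops₀)) M (torusIdx (d := d) (le_trans (by norm_num) hL2) t) m) P U₀ := by
  have hL1 : 1 ≤ L := le_trans (by norm_num) hL2
  set i : ZdIdx d L := torusIdx (d := d) hL1 t with hi
  have hiΛ : i.Λs m = torusLam (d := d) m := rfl
  have hiΩ : ∀ j, i.Ω j = Set.univ := fun _ => rfl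
  have hiη : i.η = t.η := rfl
  -- the geometric hypotheses at the torus member
  have hΛ : ∀ j, j ≤ m → IsPeriodic (P / L ^ j) fun y => y ∈ i.Λs m j := by
    intro j _ y n
    show (y + ((P / L ^ j : ℕ) : ℤ) • n ∈ i.Λs m j) = (y ∈ i.Λs m j)
    rw [hiΛ, mem_torusLam_iff, mem_torusLam_iff]
  have hne : (i.Λs m m).Nonempty := by
    rw [hiΛ, torusLam_self]
    exact Set.univ_nonempty
  have hΛb : ∀ j, j ≤ m → ∀ κ : Fin d, IsPeriodic (P / L ^ j) (fun z => (z, κ) ∈ (fun m => torusLamb (d := d) m) m j) := by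
    intro j _ κ z n
    show ((z + ((P / L ^ j : ℕ) : ℤ) • n, κ) ∈ torusLamb (d := d) m j) = ((z, κ) ∈ torusLamb (d := d) m j)
    rw [B8Thm2TorusMember.mem_torusLamb_iff, B8Thm2TorusMember.mem_torusLamb_iff]
  have hbox : ∀ j, 1 ≤ j → j ≤ m → ∀ c ∈ (fun m => torusLamb (d := d) m) m j, ∀ x, InBox (loK L j c.1) (bondHiK L j c.1 c.2) x → x ∈ i.Ω (j - 1) :=
    fun j _ _ _ _ x _ => by rw [hiΩ]; exact Set.mem_univ x
  have hinj : ∀ U₀ ∈ 𝒰, QprimeStarPerInjective (𝔸 := 𝔸) (d := d) P L U₀ m (i.Λs m) := by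
    intro U₀ _
    refine B9Eq325QGGQInvZdPer.qprimeStarPerInjective_of_single_level hP le_rfl fun j _ hjm y hsat => hjm ?_
    unfold B9Eq325QGGQInvZdPer.InSat at hsat
    rw [hiΛ, mem_torusLam_iff] at hsat
    exact hsat
  -- the flat positivity of the genuine periodic `Δ_a(U₁)` at the torus member: dag-n06-b g23's `B9Thm311FlatHolonomyKernelZdPer`, BY NAME
  have hposU₁ : ∀ A ∈ domSubHPer (d := d) (𝔸 := 𝔸) P, A ≠ 0 →
      0 < bondPairPer τ P A (deltaAOf i.η (opsAllZdPer τ L P (fun m => torusLamb (d := d) m) ops₀ M i m) U₁ A) :=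
    fun A hA hA0 => B9Thm311FlatHolonomyKernelZdPer.bondPairPer_deltaAOf_opsAllZdPer_pos_of_flat τ P hτt hτs hτp hL2 ops₀ M i hiΛ rfl hiΩ hP
      hU₁ hU₁per hflat hA hA0
  have h := regularAtHPer_eventually_opsAllZdPer_of_flat τ hτp hτt hτs hL2 (fun m => torusLamb (d := d) m) ops₀ M i m hP hΛ le_rfl hne hΛb hbox h1
    hU₁ hU₁per hflat hunit hper hreg hT hinj hposU₁
  rw [hiη] at h
  exact h

include hτp hτt hτs in
/-- ★★★★ **THE SAME WITHIN THE CANONICAL REGIME SET — NO DISPLAYED BINDER**: for `2 ≤ L`, `Lᵐ ∣ P`, a faithful Hermitian tracial `τ` on a finite-dimensional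
fibre and EVERY flat unitary `P`-periodic background `U₁` (plaquette variables `≡ 1`, any holonomy), `RegularAtHPer` — «`G_𝔤^per(U₀) = (Δ_a(U₀))⁻¹` exists» for
the genuine periodic record at `torusIdx` — holds for all `U₀` NEAR `U₁` WITHIN the canonical regime set `{U₀ unitary, P-periodic, in the class (1.7) of the
member at truncation m (α = α_Q∕L²), Ū₀ʲ(Γ) unitary for j ≤ m}` (which contains `U₁`: §1).  dag-n06-w4's `regularAtHPer_eventually_one_torusIdx_canonical`
is the case `U₁ = 1`. [cite: Balaban1985BackgroundPropagators, Thm 3.11 p.416, (3.26)–(3.27) p.395; Balaban1985RegularSpaces, (1.7) p.77, (1.58) p.86, p.77 («Ω_j = T_η»)] -/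
theorem regularAtHPer_eventually_torusIdx_canonical_of_flat (hL2 : 2 ≤ L) (t : TorusMember) (ops₀ : ℝ → ZdIdx d L → ℕ → OpsZd d 𝔸) (M : ℝ) (m : ℕ)
    (hP : L ^ m ∣ P) {U₁ : Site d → Fin d → 𝔸ˣ}
    (hU₁ : ∀ x κ, U₁ x κ ∈ unitaryUnits 𝔸) (hU₁per : IsPeriodic P U₁) (hflat : ∀ (κ ν : Fin d) (x : Site d), plaqF U₁ κ ν x = 1) :
    ∀ᶠ U₀ in 𝓝[{U₀ : Site d → Fin d → 𝔸ˣ | (∀ (x : Site d) (κ : Fin d), U₀ x κ ∈ unitaryUnits 𝔸) ∧ IsPeriodic P U₀ ∧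
        Reg17 L m (torusIdx (d := d) (le_trans (by norm_num) hL2) t).Ω (alphaQ d L / (L : ℝ) ^ 2) U₀ ∧
        ∀ j, j ≤ m → ∀ (x y : Site d), bgT L U₀ j x y ∈ unitaryUnits 𝔸}] U₁,
      RegularAtHPer t.η (opsLandauPer τ P (withDpZd (withQQP τ L (fun m => torusLamb m) ops₀)) M (torusIdx (d := d) (le_trans (by norm_num) hL2) t) m) P U₀ := by
  have hL1 : 1 ≤ L := le_trans (by norm_num) hL2
  have hL0 : (0 : ℝ) < L := by exact_mod_cast (lt_of_lt_of_le (by norm_num) hL2)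
  refine regularAtHPer_eventually_torusIdx_of_flat τ hτp hτt hτs hL2 t ops₀ M m hP ⟨hU₁, hU₁per, ?_, ?_⟩ hU₁ hU₁per hflat (fun U₀ hU₀ => hU₀.1)
    (fun U₀ hU₀ => hU₀.2.1) (fun U₀ hU₀ => hU₀.2.2.1) (fun U₀ hU₀ => hU₀.2.2.2)
  · exact reg17_of_flat hL1 m _ (div_pos (alphaQ_pos d hL1) (pow_pos hL0 2)) hflat
  · exact fun j _ x y => bgT_mem_unitaryUnits_of_flat L hU₁ hflat j x y

end TorusMember

end Literature.MathematicalPhysics.QuantumFieldTheory.Balaban1983to89.B9Thm311OpenAtFlatHolonomyZdPer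

end
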